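import Summits.CriticalPhenomena.SAWScalingLimit.Theorems.SAWTotalPositivityBoundaryTP2Defs
import Summits.CriticalPhenomena.SAWScalingLimit.Theorems.SAWTotalPositivityBoundaryTP2Kernel
import Summits.CriticalPhenomena.SAWScalingLimit.Theorems.SAWTotalPositivityBoundaryTP2Symmetry
import Summits.CriticalPhenomena.SAWScalingLimit.Theorems.SAWTotalPositivityBoundaryTP2LadderKernelsInterior
import Summits.CriticalPhenomena.SAWScalingLimit.Theorems.EdgeOfPositivity.Negative.EdgeOfPositivityRectDomain
import HarnessLib

/-!
# Crux `BoundaryTP2` (stmt-CriticalPhenomena-7115), line `Sketch`: two bottom sites left of two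
top sites of a ladder, crossing pairing vs adjacent pairing

Tool stub `stub_ladder_bbtt_adjacent` of the line's skeleton: on the ladder
`R_L = discreteDomainGraph (rectDomain L 1) 1` (sites `{0..L} × {0,1}`), for the boundary quadruple
`(c₁,0), (c₂,0)` on the bottom row and `(d₁,1), (d₂,1)` on the top row with
`c₁ < c₂ < d₂ < d₁ ≤ L` (cyclic order `(c₁,0),(c₂,0),(d₁,1),(d₂,1)`) and `0 ≤ x ≤ 1/2`, the crossing
pairing weighs at most the adjacent one:

  `Z((c₁,0),(d₁,1)) Z((c₂,0),(d₂,1)) ≤ Z((c₁,0),(c₂,0)) Z((d₁,1),(d₂,1))`.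

Proof. By `stub_ladderKernels_interior` every two-point kernel of the ladder has the rank-two form
`Z((i,r),(j,s)) = x^{n+1}/2 · (a_i b_j P^n + ρ a'_i b'_j M^n)`, `n + 1 = j - i`, `P = 1+x`,
`M = 1-x`, `a_i = P + E_i`, `a'_i = M - E_i`, `b_j = P + E_{L-j}`, `b'_j = M - E_{L-j}`,
`E_k = Σ_{d<k} x^{2d+3}`, `ρ = +1` for `r = s` and `ρ = -1` otherwise (`ladderBbtt_kernel_same`,
`ladderBbtt_kernel_cross`). Since `E_k (1-x²) ≤ x³`, `0 ≤ E_k ≤ 1/6` on `[0, 1/2]`, so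
`a', b', M ≥ 0`: the two crossing kernels (opposite rows, `ρ = -1`) are at most their main parts
`x^{n+1}/2 · a b P^n`, the two adjacent kernels (same row, `ρ = +1`; the top pair after
`pathKernel_comm`) are at least their main parts. With `u+1 = c₂-c₁`, `m+1 = d₂-c₂`, `w+1 = d₁-d₂`
the claim reduces to `x^{2m+2} P^{2m+2} a_{c₂} b_{d₂} ≤ a_{d₂} b_{c₂}`, which follows from
`a_{c₂} ≤ a_{d₂}`, `b_{d₂} ≤ b_{c₂}` (`E_k` is monotone in `k`) and `(x P)^{2m+2} ≤ 1`
(`x (1+x) ≤ 3/4`).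
-/

noncomputable section

namespace Summit.CriticalPhenomena.SAWScalingLimit.Theorems.BoundaryTP2

open Literature.Probability.LatticeModels Literature.Probability.RandomPlanarGeometry
open Summit.CriticalPhenomena.SAWScalingLimit.Theorems.EdgeOfPositivity.Negative
open scoped ENNReal

/-! ## The excursion sums `E_k = Σ_{d<k} x^{2d+3}` -/

/-- `E_k ≥ 0` for `x ≥ 0`. [folklore] -/
private theorem ladderBbtt_E_nonneg {x : ℝ} (hx : 0 ≤ x) (k : ℕ) :
    0 ≤ ∑ d ∈ Finset.range k, x ^ (2 * d + 3) :=
  Finset.sum_nonneg fun _ _ => pow_nonneg hx _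

/-- Telescoping: `E_k (1 - x²) + x^{2k+3} = x³`. [folklore] -/
private theorem ladderBbtt_E_telescope (x : ℝ) (k : ℕ) :
    (∑ d ∈ Finset.range k, x ^ (2 * d + 3)) * (1 - x ^ 2) + x ^ (2 * k + 3) = x ^ 3 := by
  induction k with
  | zero => simp
  | succ k ih =>
    rw [Finset.sum_range_succ]
    linear_combination ih

/-- Powers of `x ∈ [0, 1/2]` are at most the powers of `1/2`. [folklore] -/
private theorem ladderBbtt_pow_le {x : ℝ} (hx0 : 0 ≤ x) (hx : x ≤ 1 / 2) (n : ℕ) :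
    x ^ n ≤ (1 / 2) ^ n :=
  pow_le_pow_left₀ hx0 hx n

/-- `E_k ≤ 1/6` for `0 ≤ x ≤ 1/2` (from `E_k (1 - x²) ≤ x³ ≤ 1/8` and `1 - x² ≥ 3/4`).
[folklore] -/
private theorem ladderBbtt_E_le {x : ℝ} (hx0 : 0 ≤ x) (hx : x ≤ 1 / 2) (k : ℕ) :
    ∑ d ∈ Finset.range k, x ^ (2 * d + 3) ≤ 1 / 6 := by
  have h := ladderBbtt_E_telescope x k
  have hE := ladderBbtt_E_nonneg hx0 k
  have hk : 0 ≤ x ^ (2 * k + 3) := pow_nonneg hx0 _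
  have hx2 := ladderBbtt_pow_le hx0 hx 2
  have hx3 := ladderBbtt_pow_le hx0 hx 3
  norm_num at hx2 hx3
  nlinarith [mul_nonneg hE (by linarith : (0 : ℝ) ≤ 1 / 4 - x ^ 2)]

/-- `E_k` is monotone in `k` for `x ≥ 0`. [folklore] -/
private theorem ladderBbtt_E_mono {x : ℝ} (hx : 0 ≤ x) {k l : ℕ} (hkl : k ≤ l) :
    ∑ d ∈ Finset.range k, x ^ (2 * d + 3) ≤ ∑ d ∈ Finset.range l, x ^ (2 * d + 3) :=
  Finset.sum_le_sum_of_subset_of_nonneg (Finset.range_mono hkl) fun _ _ _ => pow_nonneg hx _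

/-! ## The rank-two form of the ladder kernels -/

/-- Same-row kernels of the ladder `{0..L}×{0,1}` in rank-two form: for `i + n + 1 = j ≤ L`, a row
`r ∈ {0,1}` and `x ≥ 0`, `Z_{R_L}((i,r),(j,r)) = x^{n+1}/2 · (a_i b_j (1+x)^n + a'_i b'_j (1-x)^n)` with
`a_i = 1+x+E_i`, `a'_i = 1-x-E_i`, `b_j = 1+x+E_{L-j}`, `b'_j = 1-x-E_{L-j}` (a regrouping of
`stub_ladderKernels_interior`). [folklore] -/
private theorem ladderBbtt_kernel_same (L i j n : ℕ) (hn : i + n + 1 = j) (hjL : j ≤ L) {x : ℝ}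
    (hx : 0 ≤ x) (r : ℤ) (hr : r = 0 ∨ r = 1) :
    pathKernel (discreteDomainGraph (rectDomain L 1) 1) x (st i r) (st j r) =
      ENNReal.ofReal (x ^ (n + 1) / 2 *
        ((1 + x + ∑ d ∈ Finset.range i, x ^ (2 * d + 3)) *
              (1 + x + ∑ d ∈ Finset.range (L - j), x ^ (2 * d + 3)) * (1 + x) ^ n +
          (1 - x - ∑ d ∈ Finset.range i, x ^ (2 * d + 3)) *
              (1 - x - ∑ d ∈ Finset.range (L - j), x ^ (2 * d + 3)) * (1 - x) ^ n)) := by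
  rw [stub_ladderKernels_interior L i j (by omega) hjL hx r r hr hr, if_pos rfl]
  congr 1
  subst hn
  have e1 : i + n + 1 - i = n + 1 := by omega
  have e2 : n + 1 - 1 = n := rfl
  rw [e1, e2]
  ring

/-- Opposite-row kernels of the ladder `{0..L}×{0,1}` in rank-two form: for `i + n + 1 = j ≤ L`
and `x ≥ 0`, `Z_{R_L}((i,0),(j,1)) = x^{n+1}/2 · (a_i b_j (1+x)^n - a'_i b'_j (1-x)^n)` (a regrouping
of `stub_ladderKernels_interior`). [folklore] -/
private theorem ladderBbtt_kernel_cross (L i j n : ℕ) (hn : i + n + 1 = j) (hjL : j ≤ L) {x : ℝ}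
    (hx : 0 ≤ x) :
    pathKernel (discreteDomainGraph (rectDomain L 1) 1) x (st i 0) (st j 1) =
      ENNReal.ofReal (x ^ (n + 1) / 2 *
        ((1 + x + ∑ d ∈ Finset.range i, x ^ (2 * d + 3)) *
              (1 + x + ∑ d ∈ Finset.range (L - j), x ^ (2 * d + 3)) * (1 + x) ^ n -
          (1 - x - ∑ d ∈ Finset.range i, x ^ (2 * d + 3)) *
              (1 - x - ∑ d ∈ Finset.range (L - j), x ^ (2 * d + 3)) * (1 - x) ^ n)) := by
  rw [stub_ladderKernels_interior L i j (by omega) hjL hx 0 1 (Or.inl rfl) (Or.inr rfl),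
    if_neg (by norm_num)]
  congr 1
  subst hn
  have e1 : i + n + 1 - i = n + 1 := by omega
  have e2 : n + 1 - 1 = n := rfl
  rw [e1, e2]
  ring

/-! ## Real inequalities in the rank-two variables -/

/-- The main part `a b (1+x)^k` of a kernel is nonnegative. [folklore] -/
private theorem ladderBbtt_main_nonneg {x e f : ℝ} (k : ℕ) (hx0 : 0 ≤ x) (he : 0 ≤ e)
    (hf : 0 ≤ f) : 0 ≤ (1 + x + e) * (1 + x + f) * (1 + x) ^ k := by
  positivity

/-- The correction part `a' b' (1-x)^k` of a kernel is nonnegative (`a', b', 1-x ≥ 0` for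
`x ≤ 1/2`, `e, f ≤ 1/6`). [folklore] -/
private theorem ladderBbtt_sub_nonneg {x e f : ℝ} (k : ℕ) (hx : x ≤ 1 / 2) (he : e ≤ 1 / 6)
    (hf : f ≤ 1 / 6) : 0 ≤ (1 - x - e) * (1 - x - f) * (1 - x) ^ k :=
  mul_nonneg (mul_nonneg (by linarith) (by linarith)) (pow_nonneg (by linarith) k)

/-- The correction part is at most the main part: `a' b' (1-x)^k ≤ a b (1+x)^k`. [folklore] -/
private theorem ladderBbtt_sub_le_main {x e f : ℝ} (k : ℕ) (hx0 : 0 ≤ x) (hx : x ≤ 1 / 2)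
    (he0 : 0 ≤ e) (hf0 : 0 ≤ f) (hf : f ≤ 1 / 6) :
    (1 - x - e) * (1 - x - f) * (1 - x) ^ k ≤ (1 + x + e) * (1 + x + f) * (1 + x) ^ k :=
  mul_le_mul (mul_le_mul (by linarith) (by linarith) (by linarith) (by linarith))
    (pow_le_pow_left₀ (by linarith) (by linarith) k) (pow_nonneg (by linarith) k)
    (mul_nonneg (by linarith) (by linarith))

/-- The rank-two form of an opposite-row kernel is nonnegative. [folklore] -/
private theorem ladderBbtt_cross_nonneg {x e f : ℝ} (k : ℕ) (hx0 : 0 ≤ x) (hx : x ≤ 1 / 2)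
    (he0 : 0 ≤ e) (hf0 : 0 ≤ f) (hf : f ≤ 1 / 6) :
    0 ≤ x ^ (k + 1) / 2 *
      ((1 + x + e) * (1 + x + f) * (1 + x) ^ k - (1 - x - e) * (1 - x - f) * (1 - x) ^ k) :=
  mul_nonneg (by positivity) (sub_nonneg.2 (ladderBbtt_sub_le_main k hx0 hx he0 hf0 hf))

/-- An opposite-row kernel is at most its main part. [folklore] -/
private theorem ladderBbtt_cross_upper {x e f : ℝ} (k : ℕ) (hx0 : 0 ≤ x) (hx : x ≤ 1 / 2)
    (he : e ≤ 1 / 6) (hf : f ≤ 1 / 6) :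
    x ^ (k + 1) / 2 *
        ((1 + x + e) * (1 + x + f) * (1 + x) ^ k - (1 - x - e) * (1 - x - f) * (1 - x) ^ k) ≤
      x ^ (k + 1) / 2 * ((1 + x + e) * (1 + x + f) * (1 + x) ^ k) :=
  mul_le_mul_of_nonneg_left (sub_le_self _ (ladderBbtt_sub_nonneg k hx he hf)) (by positivity)

/-- The rank-two form of a same-row kernel is nonnegative. [folklore] -/
private theorem ladderBbtt_same_nonneg {x e f : ℝ} (k : ℕ) (hx0 : 0 ≤ x) (hx : x ≤ 1 / 2)
    (he0 : 0 ≤ e) (he : e ≤ 1 / 6) (hf0 : 0 ≤ f) (hf : f ≤ 1 / 6) :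
    0 ≤ x ^ (k + 1) / 2 *
      ((1 + x + e) * (1 + x + f) * (1 + x) ^ k + (1 - x - e) * (1 - x - f) * (1 - x) ^ k) :=
  mul_nonneg (by positivity)
    (add_nonneg (ladderBbtt_main_nonneg k hx0 he0 hf0) (ladderBbtt_sub_nonneg k hx he hf))

/-- A same-row kernel is at least its main part. [folklore] -/
private theorem ladderBbtt_same_lower {x e f : ℝ} (k : ℕ) (hx0 : 0 ≤ x) (hx : x ≤ 1 / 2)
    (he : e ≤ 1 / 6) (hf : f ≤ 1 / 6) :
    x ^ (k + 1) / 2 * ((1 + x + e) * (1 + x + f) * (1 + x) ^ k) ≤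
      x ^ (k + 1) / 2 *
        ((1 + x + e) * (1 + x + f) * (1 + x) ^ k + (1 - x - e) * (1 - x - f) * (1 - x) ^ k) :=
  mul_le_mul_of_nonneg_left (le_add_of_nonneg_right (ladderBbtt_sub_nonneg k hx he hf))
    (by positivity)

/-- The scalar inequality `x^{2m+2} (1+x)^{2m+2} ≤ 1` on `[0, 1/2]` (`x (1+x) ≤ 3/4`). [folklore] -/
private theorem ladderBbtt_scalar {x : ℝ} (m : ℕ) (hx0 : 0 ≤ x) (hx : x ≤ 1 / 2) :
    x ^ (2 * m + 2) * (1 + x) ^ (2 * m + 2) ≤ 1 := by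
  rw [← mul_pow]
  exact pow_le_one₀ (mul_nonneg hx0 (by linarith)) (by nlinarith)

/-- The real inequality behind `stub_ladder_bbtt_adjacent`, in the rank-two variables
`e₁ = E_{c₁}`, `e₂ = E_{c₂}`, `e₃ = E_{d₂}`, `f₂ = E_{L-c₂}`, `f₃ = E_{L-d₂}`, `f₄ = E_{L-d₁}`,
spans `c₂ - c₁ = u+1`, `d₂ - c₂ = m+1`, `d₁ - d₂ = w+1`. [folklore] -/
private theorem ladderBbtt_real {x e₁ e₂ e₃ f₂ f₃ f₄ : ℝ} (u m w : ℕ) (hx0 : 0 ≤ x)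
    (hx : x ≤ 1 / 2) (he₁ : 0 ≤ e₁) (he₁' : e₁ ≤ 1 / 6) (he₂ : 0 ≤ e₂) (he₂' : e₂ ≤ 1 / 6)
    (he₃ : 0 ≤ e₃) (he₃' : e₃ ≤ 1 / 6) (hf₂ : 0 ≤ f₂) (hf₂' : f₂ ≤ 1 / 6) (hf₃ : 0 ≤ f₃)
    (hf₃' : f₃ ≤ 1 / 6) (hf₄ : 0 ≤ f₄) (hf₄' : f₄ ≤ 1 / 6) (h₂₃ : e₂ ≤ e₃) (h₃₂ : f₃ ≤ f₂) :
    x ^ (u + m + w + 2 + 1) / 2 *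
          ((1 + x + e₁) * (1 + x + f₄) * (1 + x) ^ (u + m + w + 2) -
            (1 - x - e₁) * (1 - x - f₄) * (1 - x) ^ (u + m + w + 2)) *
        (x ^ (m + 1) / 2 *
          ((1 + x + e₂) * (1 + x + f₃) * (1 + x) ^ m -
            (1 - x - e₂) * (1 - x - f₃) * (1 - x) ^ m)) ≤
      x ^ (u + 1) / 2 *
          ((1 + x + e₁) * (1 + x + f₂) * (1 + x) ^ u + (1 - x - e₁) * (1 - x - f₂) * (1 - x) ^ u) *
        (x ^ (w + 1) / 2 *
          ((1 + x + e₃) * (1 + x + f₄) * (1 + x) ^ w +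
            (1 - x - e₃) * (1 - x - f₄) * (1 - x) ^ w)) := by
  -- the two crossing kernels from above, the two adjacent kernels from below
  have U14 := ladderBbtt_cross_upper (u + m + w + 2) hx0 hx he₁' hf₄'
  have U23 := ladderBbtt_cross_upper m hx0 hx he₂' hf₃'
  have N23 := ladderBbtt_cross_nonneg m hx0 hx he₂ hf₃ hf₃'
  have L12 := ladderBbtt_same_lower u hx0 hx he₁' hf₂'
  have L34 := ladderBbtt_same_lower w hx0 hx he₃' hf₄'
  have N12 := ladderBbtt_same_nonneg u hx0 hx he₁ he₁' hf₂ hf₂'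
  -- the key comparison of the middle factors
  have hab : (1 + x + e₂) * (1 + x + f₃) ≤ (1 + x + e₃) * (1 + x + f₂) :=
    mul_le_mul (by linarith) (by linarith) (by linarith) (by linarith)
  have key : x ^ (2 * m + 2) * (1 + x) ^ (2 * m + 2) * ((1 + x + e₂) * (1 + x + f₃)) ≤
      1 * ((1 + x + e₃) * (1 + x + f₂)) :=
    mul_le_mul (ladderBbtt_scalar m hx0 hx) hab (by positivity) (by norm_num)
  calc x ^ (u + m + w + 2 + 1) / 2 *
          ((1 + x + e₁) * (1 + x + f₄) * (1 + x) ^ (u + m + w + 2) -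
            (1 - x - e₁) * (1 - x - f₄) * (1 - x) ^ (u + m + w + 2)) *
        (x ^ (m + 1) / 2 *
          ((1 + x + e₂) * (1 + x + f₃) * (1 + x) ^ m -
            (1 - x - e₂) * (1 - x - f₃) * (1 - x) ^ m))
      ≤ x ^ (u + m + w + 2 + 1) / 2 * ((1 + x + e₁) * (1 + x + f₄) * (1 + x) ^ (u + m + w + 2)) *
          (x ^ (m + 1) / 2 * ((1 + x + e₂) * (1 + x + f₃) * (1 + x) ^ m)) :=
        mul_le_mul U14 U23 N23 (by positivity)
    _ = x ^ (u + 1) / 2 * (x ^ (w + 1) / 2) * ((1 + x + e₁) * (1 + x + f₄)) *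
          ((1 + x) ^ u * (1 + x) ^ w) *
          (x ^ (2 * m + 2) * (1 + x) ^ (2 * m + 2) * ((1 + x + e₂) * (1 + x + f₃))) := by ring
    _ ≤ x ^ (u + 1) / 2 * (x ^ (w + 1) / 2) * ((1 + x + e₁) * (1 + x + f₄)) *
          ((1 + x) ^ u * (1 + x) ^ w) * (1 * ((1 + x + e₃) * (1 + x + f₂))) :=
        mul_le_mul_of_nonneg_left key (by positivity)
    _ = x ^ (u + 1) / 2 * ((1 + x + e₁) * (1 + x + f₂) * (1 + x) ^ u) *
          (x ^ (w + 1) / 2 * ((1 + x + e₃) * (1 + x + f₄) * (1 + x) ^ w)) := by ring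
    _ ≤ x ^ (u + 1) / 2 *
          ((1 + x + e₁) * (1 + x + f₂) * (1 + x) ^ u + (1 - x - e₁) * (1 - x - f₂) * (1 - x) ^ u) *
        (x ^ (w + 1) / 2 *
          ((1 + x + e₃) * (1 + x + f₄) * (1 + x) ^ w +
            (1 - x - e₃) * (1 - x - f₄) * (1 - x) ^ w)) :=
        mul_le_mul L12 L34 (by positivity) N12

/-! ## The stub -/

/-- **Tool stub `stub_ladder_bbtt_adjacent`.** On the ladder `{0..L}×{0,1}`, for two bottom sites
`(c₁,0), (c₂,0)` left of two top sites `(d₂,1), (d₁,1)` (`c₁ < c₂ < d₂ < d₁ ≤ L`, cyclic order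
`(c₁,0),(c₂,0),(d₁,1),(d₂,1)`) and `0 ≤ x ≤ 1/2`: the crossing pairing weighs at most the
ADJACENT one, `Z((c₁,0),(d₁,1)) Z((c₂,0),(d₂,1)) ≤ Z((c₁,0),(c₂,0)) Z((d₁,1),(d₂,1))`. Mechanism:
in the rank-two form of the ladder kernels the crossing kernels (opposite rows) are at most their
main parts and the adjacent kernels (same row) at least their main parts; the crossing product of
main parts carries the extra factor `(x(1+x))^{2(d₂-c₂)} ≤ 1`, and the end corrections `E_k` only
help (`E` is monotone in `k`). [folklore] -/
theorem stub_ladder_bbtt_adjacent (L : ℕ) {c₁ c₂ d₂ d₁ : ℕ} (h₁ : c₁ < c₂) (h₂ : c₂ < d₂) (h₃ : d₂ < d₁)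
    (h₄ : d₁ ≤ L) {x : ℝ} (hx0 : 0 ≤ x) (hx : x ≤ 1 / 2) :
    pathKernel (discreteDomainGraph (rectDomain L 1) 1) x (st c₁ 0) (st d₁ 1) *
        pathKernel (discreteDomainGraph (rectDomain L 1) 1) x (st c₂ 0) (st d₂ 1) ≤
      pathKernel (discreteDomainGraph (rectDomain L 1) 1) x (st c₁ 0) (st c₂ 0) *
        pathKernel (discreteDomainGraph (rectDomain L 1) 1) x (st d₁ 1) (st d₂ 1) := by
  obtain ⟨u, hu⟩ : ∃ u, c₂ = c₁ + u + 1 := ⟨c₂ - c₁ - 1, by omega⟩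
  obtain ⟨m, hm⟩ : ∃ m, d₂ = c₂ + m + 1 := ⟨d₂ - c₂ - 1, by omega⟩
  obtain ⟨w, hw⟩ : ∃ w, d₁ = d₂ + w + 1 := ⟨d₁ - d₂ - 1, by omega⟩
  have hE := fun k => ladderBbtt_E_nonneg hx0 k
  have hE' := fun k => ladderBbtt_E_le hx0 hx k
  rw [pathKernel_comm (discreteDomainGraph (rectDomain L 1) 1) x (st d₁ 1) (st d₂ 1),
    ladderBbtt_kernel_cross L c₁ d₁ (u + m + w + 2) (by omega) h₄ hx0,
    ladderBbtt_kernel_cross L c₂ d₂ m (by omega) (by omega) hx0,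
    ladderBbtt_kernel_same L c₁ c₂ u (by omega) (by omega) hx0 0 (Or.inl rfl),
    ladderBbtt_kernel_same L d₂ d₁ w (by omega) h₄ hx0 1 (Or.inr rfl),
    ← ENNReal.ofReal_mul
      (ladderBbtt_cross_nonneg (u + m + w + 2) hx0 hx (hE c₁) (hE (L - d₁)) (hE' (L - d₁))),
    ← ENNReal.ofReal_mul
      (ladderBbtt_same_nonneg u hx0 hx (hE c₁) (hE' c₁) (hE (L - c₂)) (hE' (L - c₂)))]
  exact ENNReal.ofReal_le_ofReal (ladderBbtt_real u m w hx0 hx (hE c₁) (hE' c₁) (hE c₂) (hE' c₂)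
    (hE d₂) (hE' d₂) (hE (L - c₂)) (hE' (L - c₂)) (hE (L - d₂)) (hE' (L - d₂)) (hE (L - d₁))
    (hE' (L - d₁)) (ladderBbtt_E_mono hx0 (by omega : c₂ ≤ d₂))
    (ladderBbtt_E_mono hx0 (by omega : L - d₂ ≤ L - c₂)))

end Summit.CriticalPhenomena.SAWScalingLimit.Theorems.BoundaryTP2
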